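import Literature.IUT.HodgeTheaters.TemperedCoveringsProSigmaInertia
import HarnessLib

/-!
# [IUTchI] Prop. 2.4 (iii) from Prop. 2.4 (i) and a cusp with `I_x ≅ Ẑ(1)` BY NAME, PROOFS

Mochizuki, *Inter-universal Teichmüller theory I*, kurims manuscript (May 2020), §2, Prop. 2.4 (iii)
and its proof, p. 51 [cite: Mochizuki2012, Prop 2.4(iii) p.51] (D-0012 claim key; series status
DISPUTED — nothing on this page is contested): "The commensurable terminality of `Δ^tp_X` in `Δ̂_X`
follows immediately from assertion (i), by allowing, in assertion (i), `Λ` to range over the open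
subgroups of a pro-`Σ` Sylow subgroup of a verticial subgroup of `Δ^tp_X`".  The kernel of that
inference is `StableCurveTemperedData.prop24iii_of_prop24i'` (abc-iut-L5-t11,
`TemperedCoveringsCompactSubgroups`), whose only input besides Prop. 2.4 (i) is the ATOM "`Δ^tp_X`
contains an infinite compact totally disconnected pro-`Σ` subgroup `V`".  PROOF-ONLY file (no
definitions; nothing printed is asserted) discharging that atom BY NAME from "`I_x ≅ Ẑ(1)`"
([SemiAnbd] §6 p. 71, `TemperedCurve.inertia_equiv_zHat`) for any cusp `x`: `V :=` the pro-`l` part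
(`l ∈ Σ`) of `I_x` — infinite, compact, pro-`l`, and totally disconnected as a subspace of a group
homeomorphic to `Ẑ` (`CompactAbelianProLPart`, `TemperedCoveringsProSigmaInertia`).  ROUTE NOTE
(neutral): print takes a pro-`Σ` Sylow subgroup of a VERTICIAL subgroup; the kernel step only needs
some infinite compact totally disconnected pro-`Σ` subgroup of `Δ^tp_X`, and the pro-`l` part of a
cusp inertia group is such a subgroup whenever `X` has a cusp — the case on the IUT route (the
curves of the initial Θ-data are affine hyperbolic); the verticial route remains available through
`prop24iii_of_prop24i'` itself.  Net: `prop24iii_of_prop24i_of_equiv_zHat` — Prop. 2.4 (iii) AS TYPED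
⇐ Prop. 2.4 (i) ∧ one cusp `x` with `I_x ≃ₜ* Ẑ` ∧ `Π^tp_X` Hausdorff.
-/

namespace Literature.IUT.HodgeTheaters

open Topology
open Literature.AnabelianGeometry.SemiGraphs (IsProSigma)

universe u

/-! ### Topological plumbing -/

/-- A space admitting a continuous injection into a totally disconnected space is totally
disconnected (private plumbing). [folklore] -/
private theorem totallyDisconnectedSpace_of_continuous_injective {α β : Type*} [TopologicalSpace α]
    [TopologicalSpace β] [TotallyDisconnectedSpace β] {f : α → β} (hf : Continuous f)
    (hinj : Function.Injective f) : TotallyDisconnectedSpace α :=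
  ⟨isTotallyDisconnected_of_image hf.continuousOn hinj
      (isTotallyDisconnected_of_totallyDisconnectedSpace _)⟩

/-! ### An infinite compact pro-`Σ` subgroup: the pro-`l` part itself -/

section ProLPart

variable {Z : Type*} [Group Z] [TopologicalSpace Z] [IsTopologicalGroup Z] [CompactSpace Z]
  [TotallyDisconnectedSpace Z]

/-- In a profinite group with commuting elements having discrete quotients with elements of order
`l ^ (n + 1)` for all `n`, the pro-`l` part is an INFINITE compact pro-`Σ` subgroup (`l ∈ Σ`).
[cite: Mochizuki2012, Prop 2.4(iii) p.51] -/
theorem exists_infinite_compact_proSigma {l : ℕ} (hl : l.Prime) {S : Set ℕ} (hlS : l ∈ S)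
    (hc : ∀ a b : Z, a * b = b * a)
    (hyp : ∀ n : ℕ, ∃ (W : OpenNormalSubgroup Z) (z : Z),
      z ^ l ^ (n + 1) ∈ W.toSubgroup ∧ z ^ l ^ n ∉ W.toSubgroup) :
    ∃ P : Subgroup Z, IsCompact (P : Set Z) ∧ (P : Set Z).Infinite ∧ IsProSigma S P := by
  obtain ⟨P, hP⟩ := exists_subgroup_proLPart (Z := Z) l hc
  have hPc : IsCompact (P : Set Z) := by
    have e : (P : Set Z) =
        {x : Z | ∀ W : OpenNormalSubgroup Z, ∃ n : ℕ, x ^ l ^ n ∈ W.toSubgroup} := by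
      ext x
      exact hP x
    rw [e]
    exact (isClosed_proLPart l).isCompact
  exact ⟨P, hPc, infinite_proLPart hl P hP hyp,
    isProSigma_of_forall_exists_pow_mem hl hlS P fun x hx => (hP x).mp hx⟩

end ProLPart

/-! ### Transport along `I ≃ₜ* Ẑ` -/

section Transport

variable {I : Type*} [Group I] [TopologicalSpace I] {Z : Type*} [Group Z] [TopologicalSpace Z]

/-- "`Z` has an infinite compact pro-`Σ` subgroup" transports along isomorphisms of topological
groups. [cite: Mochizuki2012, Prop 2.4(iii) p.51] -/
theorem exists_infinite_compact_proSigma_of_continuousMulEquiv (e : I ≃ₜ* Z) {S : Set ℕ}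
    (hZ : ∃ P : Subgroup Z, IsCompact (P : Set Z) ∧ (P : Set Z).Infinite ∧ IsProSigma S P) :
    ∃ P : Subgroup I, IsCompact (P : Set I) ∧ (P : Set I).Infinite ∧ IsProSigma S P := by
  obtain ⟨P', hc, hinf, hS⟩ := hZ
  have hmem : ∀ x : I, x ∈ P'.comap e.toMonoidHom ↔ e x ∈ P' := fun x => Iff.rfl
  have hset : (P'.comap e.toMonoidHom : Set I) = e.symm '' (P' : Set Z) := by
    ext x
    rw [SetLike.mem_coe, hmem, Set.mem_image]
    constructor
    · intro hx
      exact ⟨e x, hx, e.symm_apply_apply x⟩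
    · rintro ⟨y, hy, rfl⟩
      rwa [ContinuousMulEquiv.apply_symm_apply]
  refine ⟨P'.comap e.toMonoidHom, ?_, ?_, ?_⟩
  · rw [hset]
    exact hc.image e.symm.continuous
  · rw [hset]
    exact hinf.image e.symm.injective.injOn
  · have hcod : ∀ y : P', (e.symm.toMonoidHom.comp P'.subtype) y ∈ P'.comap e.toMonoidHom := by
      intro y
      rw [hmem]
      change e (e.symm (y : Z)) ∈ P'
      rw [ContinuousMulEquiv.apply_symm_apply]
      exact y.2
    refine isProSigma_of_surjective hS
      ((e.symm.toMonoidHom.comp P'.subtype).codRestrict (P'.comap e.toMonoidHom) hcod) ?_ ?_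
    · refine continuous_induced_rng.2 ?_
      exact e.symm.continuous.comp continuous_subtype_val
    · rintro ⟨x, hx⟩
      refine ⟨⟨e x, (hmem x).mp hx⟩, Subtype.ext ?_⟩
      change e.symm (e x) = x
      exact e.symm_apply_apply x

end Transport

/-- **Infinite compact pro-`Σ` subgroups of `Ẑ`** (`Σ ∋ l` prime): the pro-`l` part `ℤ_l ⊆ Ẑ`.
[cite: Mochizuki2012, Prop 2.4(iii) p.51] -/
theorem zHat_exists_infinite_compact_proSigma {S : Set ℕ} {l : ℕ} (hl : l.Prime) (hlS : l ∈ S) :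
    ∃ P : Subgroup ZHat, IsCompact (P : Set ZHat) ∧ (P : Set ZHat).Infinite ∧ IsProSigma S P :=
  exists_infinite_compact_proSigma hl hlS ZHat.mul_comm (zHat_exists_pow_mem_and_not_mem hl)

/-! ### Prop. 2.4 (iii) from Prop. 2.4 (i) and a cusp -/

namespace StableCurveTemperedData

variable (D : StableCurveTemperedData.{u})

/-- **The pro-`Σ` Sylow atom from a cusp**: if the cusp inertia group `I_x ⊆ Δ^tp_X` is identified,
as a topological group, with `Ẑ`, then `Δ^tp_X` contains an infinite compact totally disconnected
pro-`Σ` subgroup (`Σ` the datum's nonempty set of primes) — the hypothesis `hV` of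
`prop24iii_of_prop24i'`. [cite: Mochizuki2012, Prop 2.4(iii) p.51] -/
theorem proSigmaSylowAtom_of_equiv_zHat {x : D.Cusp} (e : ↥(D.inertiaTp x) ≃ₜ* ZHat) :
    ∃ V : Subgroup D.DeltaTp, IsCompact (V : Set D.DeltaTp) ∧ (V : Set D.DeltaTp).Infinite ∧
      IsProSigma D.graph.Sigma V ∧ TotallyDisconnectedSpace V := by
  obtain ⟨l, hl⟩ := D.graph.sigma_nonempty
  have hlp : l.Prime := D.graph.sigmaHat_prime l (D.graph.sigma_subset hl)
  obtain ⟨P, hc, hinf, hS⟩ := exists_infinite_compact_proSigma_of_continuousMulEquiv e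
    (zHat_exists_infinite_compact_proSigma hlp hl)
  -- `I_x`, hence every subgroup of it, is totally disconnected
  haveI hItd : TotallyDisconnectedSpace ↥(D.inertiaTp x) :=
    totallyDisconnectedSpace_of_continuous_injective e.continuous e.injective
  refine ⟨P.map (D.inertiaTp x).subtype, ?_, ?_, ?_, ?_⟩
  · rw [Subgroup.coe_map]
    exact hc.image continuous_subtype_val
  · rw [Subgroup.coe_map]
    exact hinf.image (Subgroup.subtype_injective _).injOn
  · refine isProSigma_of_surjective hS
      (Subgroup.equivMapOfInjective P (D.inertiaTp x).subtype
        (Subgroup.subtype_injective _)).toMonoidHom ?_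
      (Subgroup.equivMapOfInjective P _ _).surjective
    refine continuous_induced_rng.2 ?_
    exact (continuous_subtype_val.comp continuous_subtype_val).congr fun _ => rfl
  · -- `P.map subtype ↪ I_x` continuously
    have hle : (P.map (D.inertiaTp x).subtype : Set D.DeltaTp) ⊆ (D.inertiaTp x : Set D.DeltaTp) :=
      fun v hv => Subgroup.map_subtype_le _ hv
    exact totallyDisconnectedSpace_of_continuous_injective (continuous_inclusion hle)
      (Set.inclusion_injective hle)

/-- **Prop. 2.4 (iii) from Prop. 2.4 (i) and "`I_x ≅ Ẑ(1)`" BY NAME** (proof, p. 51, with the route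
note of the file header: the pro-`Σ` subgroup fed to (i) is the pro-`l` part of a cusp inertia
group): Prop. 2.4 (i) for the datum, one cusp `x` whose inertia group is identified with `Ẑ`, and
`Π^tp_X` Hausdorff. [cite: Mochizuki2012, Prop 2.4(iii) p.51] -/
theorem prop24iii_of_prop24i_of_equiv_zHat [T2Space D.PiTp] (h : D.Prop24i) {x : D.Cusp}
    (e : ↥(D.inertiaTp x) ≃ₜ* ZHat) : D.Prop24iii :=
  D.prop24iii_of_prop24i' h (D.proSigmaSylowAtom_of_equiv_zHat e)

/-- The `Δ`-half alone: `Δ^tp_X` is commensurably terminal in `Δ̂_X`, from Prop. 2.4 (i) and a cusp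
with `I_x ≅ Ẑ(1)`. [cite: Mochizuki2012, Prop 2.4(iii) p.51] -/
theorem delta_isCommensurablyTerminal_of_prop24i_of_equiv_zHat [T2Space D.PiTp] (h : D.Prop24i)
    {x : D.Cusp} (e : ↥(D.inertiaTp x) ≃ₜ* ZHat) :
    Literature.AnabelianGeometry.AbsoluteAnabelian.IsCommensurablyTerminal D.ιΔ.range :=
  D.delta_isCommensurablyTerminal_of_prop24i' h (D.proSigmaSylowAtom_of_equiv_zHat e)

end StableCurveTemperedData

end Literature.IUT.HodgeTheaters
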